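import Mathlib.Analysis.InnerProductSpace.PiL2
import Literature.Topology.FourManifolds.MMSWRasmussenGeneralPosition
import Summits.SmoothPoincare4.SmoothPoincare4.Theorems.DottedCircleRasmussenDcrGapHelperFriendsCarrierGuard
import Summits.SmoothPoincare4.SmoothPoincare4.Theorems.DottedCircleRasmussenDcrGapStubFriendsH2HF3
import Summits.SmoothPoincare4.SmoothPoincare4.Theorems.DottedCircleRasmussenDcrGapStubFriendsPi1AsmExterior
import Summits.SmoothPoincare4.SmoothPoincare4.Theorems.DottedCircleRasmussenDcrGapHelperFriendsPi1G3Aux1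

/-!
# Helper `helper_friendsPi1_G3` (loops off the core), aux file 3: pushing paths off the model handlebody
(sub-goal G3 of stub `stub_friendsPi1`, line `mk_friends`, crux `DcrGap`;
item stmt-SmoothPoincare4-16128, route route-SmoothPoincare4-DottedCircleRasmussen)

The model half of sub-goal G3.  `D_k = MMSW.modelHandlebody k = {guard ∧ G_k ≤ 1} ⊂ ℝ⁴ = ℂ_z × ℂ_w`,
`G_k = g_k(z) + |w|²` with `g_k(z) = |z|²/(40(k+1))² + Σ_j 1/|z - c_j|²`; on the open strict-guard set
`{∀ j, 1 < |z - c_j|²} ⊇ D_k` (`modelHandlebody_subset_strictGuard`) the function `G_k` is continuous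
and `D_k = {G_k ≤ 1}`.  We prove:

* `exists_thickening` — for an open `U ⊇ D_k` some open thickening
  `U_ε = {strict guard, G_k < 1 + ε}` of `D_k` lies in `U` (the compact sets
  `{guard, G_k ≤ 1 + 1/(n+1)}` decrease to `D_k`);
* `exists_pushMap` — **the capped radial push in `w`**: `Φ_τ(z, w) = (z, μ_τ w)`, `μ_τ = 1 - τ + τλ`,
  `λ² = max(1, (L - g_k(z))/|w|²)`, continuous off `{w = 0, G_k ≤ L}`, raising the level monotonically
  to `max(G_k, L)` at `τ = 1` and fixing `{G_k ≥ L}`;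
* `exists_path_push` — **paths in `U_ε` with end points off `D_k` are homotopic within `U_ε`, rel end
  points, to paths in `U_ε ∖ D_k`**: put the path in general position with respect to the planar
  piece `{w = 0, G_k ≤ L}` (codimension `2`; aux file 1,
  `FriendsPi1.exists_path_homotopicWithin_forall_notMem`, Hurewicz–Wallman (1941) Thm. IV 4), for a
  level `1 < L` below `1 + ε` and below the levels of the end points, then apply the push `Φ_τ`,
  `τ ∈ [0, 1]`;
* the registered helper `helper_friendsPi1_G3_push` packaging `U_ε`, the exit paths of
  `FriendsPi1.exists_exit` and `exists_path_push`.

Everything is proved; no definitions, no named facts, no `sorry`.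

## References

* W. Hurewicz, H. Wallman, *Dimension Theory*, Princeton (1941), Ch. IV §5, Thm. IV 4. [HurewiczWallman1941]
* R. Kirby, *The Topology of 4-Manifolds*, LNM 1374 (1989), Ch. I §2 (dotted circles). [Kirby1989]
-/

-- the prescribed namespace `Summit.<P>.<Sub>.…` duplicates `SmoothPoincare4` (P = Sub)
set_option linter.dupNamespace false
set_option linter.style.longLine false

noncomputable section

open scoped Topology unitInterval
open Set Function Metric Module
open Literature.Topology.FourManifolds Literature.Topology.FourManifolds.MMSW
open Literature.AlgebraicTopology.FundamentalGroup.VanKampen (HomotopicWithin)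

namespace Summit.SmoothPoincare4.SmoothPoincare4.Theorems.DcrGap.MkFriends

namespace FriendsPi1

/-- Local notation: `𝔼⁴ = ℝ⁴`. -/
local notation "𝔼⁴" => EuclideanSpace ℝ (Fin 4)

/-! ## Thickenings of the model handlebody inside an open neighbourhood -/

/-- **The thickenings `{guard, G_k ≤ 1 + ε}` shrink to `D_k`**: for an open `U ⊇ D_k` some open
thickening `{strict guard, G_k < 1 + ε}` lies in `U` (the sets `{guard, G_k ≤ 1 + 1/(n+1)}` are
compact, decrease, and meet in `D_k`). [folklore] -/
theorem exists_thickening {k : ℕ} {U : Set 𝔼⁴} (hU : IsOpen U) (hDU : modelHandlebody k ⊆ U) :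
    ∃ ε : ℝ, 0 < ε ∧ {y : 𝔼⁴ | (∀ j, 1 < holeTerm k j y) ∧ levelFun k y < 1 + ε} ⊆ U := by
  set D : ℕ → Set 𝔼⁴ := fun n => {y | (∀ j, 1 ≤ holeTerm k j y) ∧ levelFun k y ≤ 1 + 1 / ((n : ℝ) + 1)}
    with hD
  have hDcl : ∀ n, IsClosed (D n) := fun n =>
    (continuousOn_levelFun one_pos).preimage_isClosed_of_isClosed (isClosed_guard 1) isClosed_Iic
  have hanti : ∀ {m n}, m ≤ n → D n ⊆ D m := fun {m n} hmn y hy => ⟨hy.1, hy.2.trans (by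
    gcongr)⟩
  -- `D 0` is compact
  have hD0 : IsCompact (D 0) := by
    refine Metric.isCompact_of_isClosed_isBounded (hDcl 0) (isBounded_iff_forall_norm_le.2
      ⟨2 * ((40 * ((k : ℝ) + 1)) ^ 2 + 1), fun y hy => ?_⟩)
    have hpos : ∀ j, 0 < holeTerm k j y := fun j => one_pos.trans_le (hy.1 j)
    have h1 := FriendsH2.norm_sq_le_levelFun hpos
    have h2 : levelFun k y ≤ 2 := by have := hy.2; norm_num at this; linarith
    have hR : (1 : ℝ) ≤ (40 * ((k : ℝ) + 1)) ^ 2 + 1 := by nlinarith [sq_nonneg (40 * ((k : ℝ) + 1))]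
    nlinarith [norm_nonneg y, sq_nonneg (‖y‖ - 1)]
  -- the thickenings meet in `D_k`
  have hmem : ∀ y, (∀ n, y ∈ D n) → y ∈ modelHandlebody k := fun y hy =>
    ⟨(hy 0).1, le_of_forall_pos_lt_add fun ε hε => by
      obtain ⟨n, hn⟩ := exists_nat_one_div_lt hε
      exact (hy n).2.trans_lt (by linarith)⟩
  have hdir : Directed (fun a b => a ⊇ b) D := fun m n =>
    ⟨max m n, hanti (le_max_left _ _), hanti (le_max_right _ _)⟩
  -- some thickening lies in `U`
  obtain ⟨n, hn⟩ := (hD0.diff hU).elim_directed_family_closed D hDcl (by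
    ext y
    simp only [mem_inter_iff, mem_sdiff, mem_iInter, mem_empty_iff_false, iff_false, not_and]
    exact fun h hall => h.2 (hDU (hmem y hall))) hdir
  refine ⟨1 / ((n : ℝ) + 1), by positivity, fun y hy => by_contra fun hyU => ?_⟩
  have hyD : y ∈ D n := ⟨fun j => (hy.1 j).le, hy.2.le⟩
  exact (eq_empty_iff_forall_notMem.1 hn y) ⟨⟨hanti n.zero_le hyD, hyU⟩, hyD⟩

/-- `G_k` is continuous on the open strict-guard set. [folklore] -/
theorem continuousOn_levelFun_strictGuard (k : ℕ) :
    ContinuousOn (levelFun k) {y : 𝔼⁴ | ∀ j, 1 < holeTerm k j y} :=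
  (continuousOn_levelFun one_pos).mono fun _ hy j => le_of_lt (hy j)

/-- The thickening `{strict guard, G_k < 1 + ε}` is open. [folklore] -/
theorem isOpen_thickening (k : ℕ) (ε : ℝ) :
    IsOpen {y : 𝔼⁴ | (∀ j, 1 < holeTerm k j y) ∧ levelFun k y < 1 + ε} :=
  (continuousOn_levelFun_strictGuard k).isOpen_inter_preimage (isOpen_guard 1) isOpen_Iio

/-! ## The radial push in `w` -/

/-- The `w`-scaling `(z, w) ↦ (z, μ w)` in coordinates. -/
local notation "wsc" => fun (μ : ℝ) (y : EuclideanSpace ℝ (Fin 4)) =>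
  (WithLp.toLp 2 ![y 0, y 1, μ * y 2, μ * y 3] : EuclideanSpace ℝ (Fin 4))

/-- Scaling `w` by `1` does nothing. [folklore] -/
theorem wsc_one (y : 𝔼⁴) : wsc 1 y = y := by
  ext i; fin_cases i <;> simp

/-- Scaling `w` does not change the hole terms `|z - c_j|²`. [folklore] -/
theorem holeTerm_wsc {k : ℕ} (j : Fin k) (μ : ℝ) (y : 𝔼⁴) : holeTerm k j (wsc μ y) = holeTerm k j y := rfl

/-- **Scaling `w` by `μ` changes `G_k` by `(μ² - 1)|w|²**: `G_k(z, μ w) = G_k(z, w) + (μ² - 1)|w|²`.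
[folklore] -/
theorem levelFun_wsc (k : ℕ) (μ : ℝ) (y : 𝔼⁴) :
    levelFun k (wsc μ y) = levelFun k y + (μ ^ 2 - 1) * (y 2 ^ 2 + y 3 ^ 2) := by
  simp only [levelFun, holeTerm_wsc]
  show ((y 0) ^ 2 + (y 1) ^ 2) / _ + _ + (μ * y 2) ^ 2 + (μ * y 3) ^ 2 = _
  ring

/-- The `w`-scaling is jointly continuous in `(μ, y)`. [folklore] -/
theorem continuous_wsc : Continuous fun p : ℝ × 𝔼⁴ => wsc p.1 p.2 := by
  refine (PiLp.continuous_toLp 2 _).comp ?_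
  refine continuous_pi fun i => ?_
  fin_cases i <;> simp <;> fun_prop

/-- **The capped radial push in `w`.**  For a level `L`, there is a homotopy `Φ : ℝ × ℝ⁴ → ℝ⁴`,
`Φ(τ, (z, w)) = (z, μ_τ w)` with `μ_τ = 1 - τ + τ λ(z, w)`, `λ = √(max(1, (L - g_k(z))/|w|²))`,
continuous on the strict-guard set off `{w = 0, G_k ≤ L}`, such that: `Φ₀ = id`; `z` (hence the
guard) is unchanged; along `τ ∈ [0, 1]` the level `G_k` only increases and stays `≤ max(G_k, L)`; at
`τ = 1` it equals `max(G_k, L)` (off `w = 0`); and points with `G_k ≥ L` do not move.  (The level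
function is `G_k = g_k(z) + |w|²`, so scaling `w` up raises the level without touching `z`.)
[folklore] -/
theorem exists_pushMap (k : ℕ) (L : ℝ) :
    ∃ Φ : ℝ → 𝔼⁴ → 𝔼⁴,
      ContinuousOn (fun p : ℝ × 𝔼⁴ => Φ p.1 p.2)
        (univ ×ˢ {y | (∀ j, 1 < holeTerm k j y) ∧ (y 2 ^ 2 + y 3 ^ 2 ≠ 0 ∨ L < levelFun k y)}) ∧
      (∀ y, Φ 0 y = y) ∧
      (∀ τ y j, holeTerm k j (Φ τ y) = holeTerm k j y) ∧
      (∀ τ ∈ Icc (0 : ℝ) 1, ∀ y, y 2 ^ 2 + y 3 ^ 2 ≠ 0 →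
        levelFun k y ≤ levelFun k (Φ τ y) ∧ levelFun k (Φ τ y) ≤ max (levelFun k y) L) ∧
      (∀ y, y 2 ^ 2 + y 3 ^ 2 ≠ 0 → levelFun k (Φ 1 y) = max (levelFun k y) L) ∧
      (∀ τ y, L ≤ levelFun k y → Φ τ y = y) := by
  -- the target scale `λ` and the push
  set wsq : 𝔼⁴ → ℝ := fun y => y 2 ^ 2 + y 3 ^ 2 with hwsq
  set lam : 𝔼⁴ → ℝ := fun y => √(max 1 ((L - (levelFun k y - wsq y)) / wsq y)) with hlam
  set Φ : ℝ → 𝔼⁴ → 𝔼⁴ := fun τ y => wsc (1 - τ + τ * lam y) y with hΦ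
  have hlam1 : ∀ y, 1 ≤ lam y := fun y => Real.one_le_sqrt.2 (le_max_left _ _)
  have hlamsq : ∀ y, wsq y ≠ 0 → lam y ^ 2 * wsq y = max (wsq y) (L - (levelFun k y - wsq y)) := by
    intro y hy
    rw [hlam, Real.sq_sqrt (zero_le_one.trans (le_max_left _ _)), max_mul_of_nonneg _ _ (by positivity),
      one_mul, div_mul_cancel₀ _ hy]
  have hlam_eq_one : ∀ y, L ≤ levelFun k y → lam y = 1 := by
    intro y hy
    have h : (L - (levelFun k y - wsq y)) / wsq y ≤ 1 := by
      by_cases h0 : wsq y = 0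
      · rw [h0, div_zero]; exact zero_le_one
      · rw [div_le_one (lt_of_le_of_ne (by positivity) (Ne.symm h0))]; linarith
    show √(max 1 ((L - (levelFun k y - wsq y)) / wsq y)) = 1
    rw [max_eq_left h, Real.sqrt_one]
  have hG : ∀ τ y, levelFun k (Φ τ y) = levelFun k y + ((1 - τ + τ * lam y) ^ 2 - 1) * wsq y :=
    fun τ y => levelFun_wsc k _ y
  have hfix : ∀ τ y, L ≤ levelFun k y → Φ τ y = y := fun τ y hy => by
    simp only [hΦ, hlam_eq_one y hy, mul_one, sub_add_cancel, wsc_one]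
  -- continuity off the cores
  have hS : ∀ y ∈ {y : 𝔼⁴ | (∀ j, 1 < holeTerm k j y) ∧ y 2 ^ 2 + y 3 ^ 2 ≠ 0}, ∀ j,
      (1 : ℝ) ≤ holeTerm k j y := fun y hy j => (hy.1 j).le
  have hGc : ContinuousOn (levelFun k) {y : 𝔼⁴ | (∀ j, 1 < holeTerm k j y) ∧ y 2 ^ 2 + y 3 ^ 2 ≠ 0} :=
    (continuousOn_levelFun one_pos).mono hS
  have hwc : Continuous wsq := by simp only [hwsq]; fun_prop
  have hlamc : ContinuousOn lam {y : 𝔼⁴ | (∀ j, 1 < holeTerm k j y) ∧ y 2 ^ 2 + y 3 ^ 2 ≠ 0} := by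
    refine Real.continuous_sqrt.comp_continuousOn fun y hy => ?_
    exact (continuousWithinAt_const.max
      (((continuousWithinAt_const.sub ((hGc y hy).sub hwc.continuousWithinAt)).div
        hwc.continuousWithinAt hy.2)))
  have hμ : ContinuousOn (fun p : ℝ × 𝔼⁴ => (1 - p.1 + p.1 * lam p.2, p.2))
      (univ ×ˢ {y | (∀ j, 1 < holeTerm k j y) ∧ y 2 ^ 2 + y 3 ^ 2 ≠ 0}) := by
    refine ContinuousOn.prodMk ?_ continuousOn_snd
    refine ((continuous_const.sub continuous_fst).continuousOn).add
      (continuousOn_fst.mul (hlamc.comp continuousOn_snd fun p hp => hp.2))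
  have hc0 : ContinuousOn (fun p : ℝ × 𝔼⁴ => Φ p.1 p.2)
      (univ ×ˢ {y | (∀ j, 1 < holeTerm k j y) ∧ y 2 ^ 2 + y 3 ^ 2 ≠ 0}) :=
    continuous_wsc.comp_continuousOn hμ
  have hO0 : IsOpen {y : 𝔼⁴ | (∀ j, 1 < holeTerm k j y) ∧ y 2 ^ 2 + y 3 ^ 2 ≠ 0} :=
    (isOpen_guard 1).inter (isOpen_ne_fun (by fun_prop) continuous_const)
  have hO1 : IsOpen {y : 𝔼⁴ | (∀ j, 1 < holeTerm k j y) ∧ L < levelFun k y} :=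
    (continuousOn_levelFun_strictGuard k).isOpen_inter_preimage (isOpen_guard 1) isOpen_Ioi
  refine ⟨Φ, ?_, fun y => ?_, fun τ y j => holeTerm_wsc j _ y, fun τ hτ y hy => ?_, fun y hy => ?_, hfix⟩
  · rintro ⟨τ, y⟩ ⟨-, hy⟩
    rcases hy.2 with hw | hL
    · exact (hc0.continuousAt ((isOpen_univ.prod hO0).mem_nhds ⟨mem_univ _, hy.1, hw⟩)).continuousWithinAt
    · refine (continuous_snd.continuousAt.congr ?_).continuousWithinAt
      filter_upwards [(isOpen_univ.prod hO1).mem_nhds ⟨mem_univ τ, hy.1, hL⟩] with p hp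
      exact (hfix p.1 p.2 hp.2.2.le).symm
  · -- `Φ₀ = id`
    ext i; fin_cases i <;> simp [hΦ]
  · -- monotonicity and cap along `τ ∈ [0, 1]`
    obtain ⟨hτ0, hτ1⟩ := hτ
    have hl := hlam1 y
    have hμ1 : 1 ≤ 1 - τ + τ * lam y := by nlinarith
    have hμl : 1 - τ + τ * lam y ≤ lam y := by nlinarith
    have hpos : 0 < wsq y := lt_of_le_of_ne (by positivity) (Ne.symm hy)
    have hsq := hlamsq y hy
    have hμsq1 : 1 ≤ (1 - τ + τ * lam y) ^ 2 := one_le_pow₀ hμ1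
    have hμsq : (1 - τ + τ * lam y) ^ 2 ≤ lam y ^ 2 := pow_le_pow_left₀ (by linarith) hμl 2
    rw [hG]
    constructor
    · nlinarith
    · rw [show max (levelFun k y) L = (levelFun k y - wsq y) + max (wsq y) (L - (levelFun k y - wsq y)) by
        rw [← max_add_add_left]; congr 1 <;> ring, ← hsq]
      nlinarith
  · -- the end of the push
    rw [hG, show max (levelFun k y) L = (levelFun k y - wsq y) + max (wsq y) (L - (levelFun k y - wsq y)) by
      rw [← max_add_add_left]; congr 1 <;> ring, ← hlamsq y hy]
    ring

/-! ## Pushing paths off `D_k` inside a thickening -/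

/-- The planar inclusion `ℝ² → ℝ⁴`, `v ↦ (v, 0)`, is `C¹`. [folklore] -/
theorem contDiff_planar : ContDiff ℝ 1 (fun v : EuclideanSpace ℝ (Fin 2) =>
    (WithLp.toLp 2 ![v 0, v 1, 0, 0] : EuclideanSpace ℝ (Fin 4))) := by
  rw [contDiff_euclidean]
  intro i
  fin_cases i <;> simp <;> fun_prop

/-- **Paths in the thickening with end points off `D_k` can be pushed off `D_k`.**  In
`U_ε = {strict guard, G_k < 1 + ε}`, every path with end points off `D_k` is homotopic within `U_ε`
(rel end points) to a path in `U_ε ∖ D_k`: general position with respect to the planar piece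
`{w = 0, G_k ≤ L}` (codimension `2`, Hurewicz–Wallman (1941) Thm. IV 4) for a level `1 < L < 1 + ε`
below the levels of the end points, followed by the capped radial push in `w` up to level `L`.
[cite: HurewiczWallman1941, Ch. IV §5, Thm. IV 4 and Cor. 1] -/
theorem exists_path_push {k : ℕ} {ε : ℝ} (hε : 0 < ε) {a b : 𝔼⁴} (β : Path a b)
    (hβ : ∀ s, β s ∈ {y : 𝔼⁴ | (∀ j, 1 < holeTerm k j y) ∧ levelFun k y < 1 + ε})
    (ha : a ∉ modelHandlebody k) (hb : b ∉ modelHandlebody k) :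
    ∃ β' : Path a b, (∀ s, β' s ∈ {y : 𝔼⁴ | (∀ j, 1 < holeTerm k j y) ∧ levelFun k y < 1 + ε} ∧
      β' s ∉ modelHandlebody k) ∧
      HomotopicWithin {y : 𝔼⁴ | (∀ j, 1 < holeTerm k j y) ∧ levelFun k y < 1 + ε} β β' := by
  set U₁ : Set 𝔼⁴ := {y | (∀ j, 1 < holeTerm k j y) ∧ levelFun k y < 1 + ε} with hU₁
  -- the level `L`
  have haU : a ∈ U₁ := by simpa only [β.source] using hβ 0
  have hbU : b ∈ U₁ := by simpa only [β.target] using hβ 1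
  have hGa : 1 < levelFun k a := FriendsH2.one_lt_levelFun_of_not_mem (fun j => one_pos.trans (haU.1 j)) ha
  have hGb : 1 < levelFun k b := FriendsH2.one_lt_levelFun_of_not_mem (fun j => one_pos.trans (hbU.1 j)) hb
  set m : ℝ := min (min (levelFun k a) (levelFun k b)) (1 + ε) with hm
  have hm1 : 1 < m := lt_min (lt_min hGa hGb) (by linarith)
  set L : ℝ := (1 + m) / 2 with hL
  have hLm : L < m := by rw [hL]; linarith
  have hL1 : 1 < L := by rw [hL]; linarith
  have hLa : L < levelFun k a := hLm.trans_le ((min_le_left _ _).trans (min_le_left _ _))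
  have hLb : L < levelFun k b := hLm.trans_le ((min_le_left _ _).trans (min_le_right _ _))
  have hLε : L < 1 + ε := hLm.trans_le (min_le_right _ _)
  -- general position with respect to the planar piece `T = {w = 0, G_k ≤ L}`
  set T : Set 𝔼⁴ := {y | y 2 = 0 ∧ y 3 = 0 ∧ levelFun k y ≤ L} with hT
  have hTsub : T ⊆ ⋃ _ : Unit, (fun v : EuclideanSpace ℝ (Fin 2) =>
      (WithLp.toLp 2 ![v 0, v 1, 0, 0] : EuclideanSpace ℝ (Fin 4))) '' univ := by
    intro y hy
    refine mem_iUnion.2 ⟨(), WithLp.toLp 2 ![y 0, y 1], mem_univ _, ?_⟩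
    ext i
    fin_cases i <;> simp [hy.1, hy.2.1]
  have hdim : finrank ℝ (EuclideanSpace ℝ (Fin 2)) + 2 ≤ finrank ℝ (EuclideanSpace ℝ (Fin 4)) := by simp
  have haT : a ∉ T := fun h => absurd h.2.2 (not_le.2 hLa)
  have hbT : b ∉ T := fun h => absurd h.2.2 (not_le.2 hLb)
  obtain ⟨β₁, hβ₁, hhom₁⟩ := exists_path_homotopicWithin_forall_notMem hdim (fun _ : Unit => _)
    (fun _ => univ) (fun _ => isOpen_univ) (fun _ => contDiff_planar.contDiffOn) hTsub
    (isOpen_thickening k ε) β hβ haT hbT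
  -- the push
  obtain ⟨Φ, hΦc, hΦ0, hΦg, hΦmono, hΦ1, hΦfix⟩ := exists_pushMap k L
  have hwsq : ∀ y : 𝔼⁴, y 2 ^ 2 + y 3 ^ 2 = 0 → y 2 = 0 ∧ y 3 = 0 := fun y h => by
    constructor <;> nlinarith [sq_nonneg (y 2), sq_nonneg (y 3)]
  have halt : ∀ s, (β₁ s) 2 ^ 2 + (β₁ s) 3 ^ 2 ≠ 0 ∨ L < levelFun k (β₁ s) := fun s => by
    by_cases hw : (β₁ s) 2 ^ 2 + (β₁ s) 3 ^ 2 = 0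
    · refine Or.inr (not_le.1 fun hle => (hβ₁ s).2 ⟨(hwsq _ hw).1, (hwsq _ hw).2, hle⟩)
    · exact Or.inl hw
  have hβ₁S : ∀ s, β₁ s ∈ {y : 𝔼⁴ | (∀ j, 1 < holeTerm k j y) ∧ (y 2 ^ 2 + y 3 ^ 2 ≠ 0 ∨ L < levelFun k y)} :=
    fun s => ⟨(hβ₁ s).1.1, halt s⟩
  -- the pushed points stay in `U₁`, and at `τ = 1` are off `D_k`
  have hmemU : ∀ (τ : I) s, Φ τ (β₁ s) ∈ U₁ := fun τ s => by
    rcases halt s with hw | hLs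
    · refine ⟨fun j => by rw [hΦg]; exact (hβ₁ s).1.1 j, ?_⟩
      exact (hΦmono τ ⟨τ.2.1, τ.2.2⟩ _ hw).2.trans_lt (max_lt (hβ₁ s).1.2 hLε)
    · rw [hΦfix τ _ hLs.le]; exact (hβ₁ s).1
  have hnotD : ∀ s, Φ 1 (β₁ s) ∉ modelHandlebody k := fun s hD => by
    rcases halt s with hw | hLs
    · have h1 := hΦ1 _ hw
      exact absurd hD.2 (not_le.2 (by rw [h1]; exact hL1.trans_le (le_max_right _ _)))
    · rw [hΦfix 1 _ hLs.le] at hD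
      exact absurd hD.2 (not_le.2 (hL1.trans hLs))
  have hcont : Continuous fun z : I × I => Φ (z.1 : ℝ) (β₁ z.2) :=
    hΦc.comp_continuous (f := fun z : I × I => ((z.1 : ℝ), β₁ z.2)) (by fun_prop)
      fun z => ⟨mem_univ _, hβ₁S z.2⟩
  set β₂ : Path a b :=
    { toFun := fun s => Φ 1 (β₁ s)
      continuous_toFun := hcont.comp (f := fun s : I => ((1 : I), s)) (by fun_prop)
      source' := by rw [β₁.source, hΦfix 1 a hLa.le]
      target' := by rw [β₁.target, hΦfix 1 b hLb.le] } with hβ₂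
  have hhom₂ : HomotopicWithin U₁ β₁ β₂ := by
    refine ⟨{ toFun := fun z => Φ (z.1 : ℝ) (β₁ z.2)
              continuous_toFun := hcont
              map_zero_left := fun s => by simp [hΦ0]
              map_one_left := fun s => rfl
              prop' := fun τ s hs => ?_ }, fun z => hmemU z.1 z.2⟩
    simp only [mem_insert_iff, mem_singleton_iff] at hs
    show Φ (τ : ℝ) (β₁ s) = β₁ s
    rcases hs with rfl | rfl
    · rw [β₁.source, hΦfix _ a hLa.le]
    · rw [β₁.target, hΦfix _ b hLb.le]
  exact ⟨β₂, fun s => ⟨hmemU 1 s, hnotD s⟩, hhom₁.trans hhom₂⟩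

end FriendsPi1

/-- **Pushing paths off the model handlebody** (registered helper `helper_friendsPi1_G3_push`, aux
part 3 of sub-goal G3 of `stub_friendsPi1`): every open `U ⊇ D_k` contains an open `U₁ ⊇ D_k` such that
every point of `D_k` is joined inside `U₁` to a point off `D_k`, and every path in `U₁` with end points
off `D_k` is homotopic within `U₁`, rel end points, to a path in `U₁ ∖ D_k` (general position with
respect to the planar cores, Hurewicz–Wallman (1941) Thm. IV 4, then the radial push in `w`).
[cite: HurewiczWallman1941, Ch. IV §5, Thm. IV 4 and Cor. 1] -/
theorem helper_friendsPi1_G3_push : ∀ (k : ℕ) (U : Set (EuclideanSpace ℝ (Fin 4))), IsOpen U → Literature.Topology.FourManifolds.MMSW.modelHandlebody k ⊆ U → ∃ U₁ : Set (EuclideanSpace ℝ (Fin 4)), IsOpen U₁ ∧ Literature.Topology.FourManifolds.MMSW.modelHandlebody k ⊆ U₁ ∧ U₁ ⊆ U ∧ (∀ y ∈ Literature.Topology.FourManifolds.MMSW.modelHandlebody k, ∃ y' ∈ U₁, y' ∉ Literature.Topology.FourManifolds.MMSW.modelHandlebody k ∧ JoinedIn U₁ y y') ∧ (∀ (a b :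 EuclideanSpace ℝ (Fin 4)) (β : Path a b), (∀ s, β s ∈ U₁) → a ∉ Literature.Topology.FourManifolds.MMSW.modelHandlebody k → b ∉ Literature.Topology.FourManifolds.MMSW.modelHandlebody k → ∃ β' : Path a b, (∀ s, β' s ∈ U₁ ∧ β' s ∉ Literature.Topology.FourManifolds.MMSW.modelHandlebody k) ∧ Literature.AlgebraicTopology.FundamentalGroup.VanKampen.HomotopicWithin U₁ β β') := by
  intro k U hU hDU
  obtain ⟨ε, hε, hεU⟩ := FriendsPi1.exists_thickening hU hDU
  have hDU₁ : modelHandlebody k ⊆ {y | (∀ j, 1 < holeTerm k j y) ∧ levelFun k y < 1 + ε} :=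
    fun y hy => ⟨modelHandlebody_subset_strictGuard k hy, hy.2.trans_lt (by linarith)⟩
  refine ⟨_, FriendsPi1.isOpen_thickening k ε, hDU₁, hεU, fun y hy => ?_, fun a b β hβ ha hb =>
    FriendsPi1.exists_path_push hε β hβ ha hb⟩
  obtain ⟨y', hy', hy'D, hj⟩ := FriendsPi1.exists_exit k (FriendsPi1.isOpen_thickening k ε) hDU₁ hy
  exact ⟨y', hy', hy'D, hj⟩

end Summit.SmoothPoincare4.SmoothPoincare4.Theorems.DcrGap.MkFriends

end
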